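import Summits.HodgeConjecture.CorCM.RelativePairFlipShadows
import Summits.HodgeConjecture.CorCM.ParallelShadowsCMFieldsHodge
import Literature.AlgebraicGeometry.Pohlmann1968.DegenerateCMTypeOverSubfield
import HarnessLib

/-!
# A generic CM field INSIDE the CM field of the partner, I (CM types): the pair is additive UNLESS the partner's type
# has constant unequal multiplicities over the base type — the exact criterion for towers with relative pair flips

COR-CM (cell `pub-hodgecm2`, binder seat `b16` gen 52, count-neutral claim TOWER-SHADOW, file F3 — CM fields; theorems
only, no definition, no named fact, no `sorry`).  NEW as stated, hence under `Summits/`.  HONEST FRAMING: unconditional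
statements about the Kubota–Dodson rank of pairs of CM types (`Hg(A₀ × A₁)` versus `Hg(A₀) × Hg(A₁)`); `HC_CM` is neither
used nor asserted.

SETTING.  Two slots `i₀ ≠ i₁`, `I = {i₀, i₁}`, CM fields `K_{i₀} = K₀`, `K_{i₁} = K₁` with a field embedding
`j : K₀ → K₁` (`[K₁ : ℚ] = m · [K₀ : ℚ]`), types `Φ₀ = Φ_{i₀}`, `Φ₁ = Φ_{i₁}`.  Over an embedding `x : K₀ → ℂ` the type `Φ₁`
has the MULTIPLICITY `n(x) = #{y ∈ Φ₁ | y ∘ j = x}` (out of `m` extensions).  HYPOTHESIS (RPF) — RELATIVE PAIR FLIPS: for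
every `x` some automorphism `σ` of `ℂ` has `σ ∘ x = x̄` and FIXES EVERY embedding `y` of `K₁` with `y ∘ j ∉ {x, x̄}`.  Then
`K₀` has pair flips (`pairFlip_of_relPairFlip`) — it is a GENERIC CM field of its degree, `U(Φ₀)` irreducible and `Φ₀`
nondegenerate (`isNondegenerate_base_of_relPairFlip`).  (RPF) holds e.g. for an imaginary quadratic `K₀` inside any `K₁`,
and for `K₁ = K₀·F₁` when the pair flips of `K₀` fix the embeddings of `F₁` (sequel F4 `GenericCMSubfieldTowerHodge`,
§2).  The tree had: `K₀` pair-flip with `L₀ ⊄ L₁` (`PairFlipCMFieldOffClosureHodge`: no common constituent), equal degrees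
(`PairFlipCompanionIsogeny`), `K₀` imaginary quadratic (`SharedImaginaryQuadraticCMFieldsHodge`), `K₀` non-Galois quartic in
an octic `K₁` (`QuarticCMSubfieldOfOcticHodge`); here `K₁ ⊇ K₀` has ANY relative degree, `U(Φ₀)` IS a constituent of
`ℚ^{Hom(K₁,ℂ)}` and gen 49's parallel-shadow obstruction (`ParallelShadowsCMFieldsHodge`) can occur — and is the ONLY one:

* §1 **`cmFamilyRank_add_card_eq_iff_of_relPairFlip`** — `rank(Φ₀, Φ₁) + 2 = rank Φ₀ + rank Φ₁ + 1`
  (`Hg(A₀ × A₁) = Hg(A₀) × Hg(A₁)`) IFF `Φ₁` does NOT lie over `Φ₀` with CONSTANT MULTIPLICITIES `(a, b)`, `a ≠ b`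
  (`n(x) = a` for `x ∈ Φ₀`, `= b` for `x ∉ Φ₀` — Yanai's condition of Gordon 9.4.3 with `S₁ = Φ₀`);
  **`isNondegenerateFamily_iff_of_relPairFlip`** — `(Φ₀, Φ₁)` is nondegenerate IFF `Φ₁` is nondegenerate and not of that
  form; `cmFamilyRank_add_card_lt_of_multiplicities_self` (the exceptional case is NOT additive, no flip hypothesis) and
  `cmFamilyRank_eq_cmTypeRank_of_multiplicities` — then `rank(Φ₀, Φ₁) = rank Φ₁` EXACTLY (COLLAPSE: `MT(A₀ × A₁) → MT(A₁)`
  is an isogeny).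
* §2 QUADRATIC STEPS (`[K₁ : ℚ] = 2[K₀ : ℚ]`): constant multiplicities `(2,0)`/`(0,2)` mean a type constant on the fibres,
  i.e. INDUCED, hence not nondegenerate (`not_isNondegenerate_of_fibrewise`, `not_isNondegenerate_of_multiplicities_zero`,
  Kubota Lemma 2), so **`isNondegenerateFamily_iff_of_relPairFlip_of_quadratic`**: `(Φ₀, Φ₁)` is nondegenerate IFF `Φ₁`
  is — for EVERY pair of types (no exceptional configuration in relative degree `2`; the first ones are `(2,1)`-types in
  relative degree `3`).
Abelian varieties, supply of (RPF), the imaginary quadratic base: sequel `GenericCMSubfieldTowerHodge`.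

## References

* [Gordon1999HodgeAVSurvey] B. B. Gordon, *A survey of the Hodge conjecture for abelian varieties*, §3 Theorem (Imai,
  Murty), 7.4–7.7 (Murty, Hazama), 9.4.3 (Yanai).
* [Kubota1965] T. Kubota, *On the field extension by complex multiplication*, Trans. AMS 118 (1965), §2, Lemma 2.
* [Dodson1984] B. Dodson, *The structure of Galois groups of CM-fields*, Trans. AMS 283 (1984), §1.1, §5.1.2.
* [MilneFT2022] J. S. Milne, *Fields and Galois Theory*, Prop. 2.7 (a).
-/

noncomputable section

open CategoryTheory CategoryTheory.Limits NumberField Module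

namespace Summit.HodgeConjecture.CorCM

open Literature.NumberTheory.ComplexMultiplication
open Literature.AlgebraicGeometry.Motives (AbelianVariety CMType)
open Literature.AlgebraicGeometry.HodgeTheory
open Literature.AlgebraicGeometry.ComplexMultiplication (IsCMTypeRealisation)
open Literature.AlgebraicGeometry.VanGeemen1994 (hodgeClassSpan)
open Literature.AlgebraicGeometry.Pohlmann1968
open Literature.Barriers.HodgeConjecture (divisorClassesSpan)
open scoped Classical

variable {I : Type} {K : I → Type} [∀ i, Field (K i)] [∀ i, NumberField (K i)] [∀ i, IsCMField (K i)] [Fintype I]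
  [DecidableEq I] {Φ : ∀ i, CMType (K i)} {i₀ i₁ : I}

omit [∀ i, IsCMField (K i)] [DecidableEq I] in
/-- `|⊔_i Hom(K_i, ℂ)| = Σ_i [K_i : ℚ]`. [folklore] -/
private theorem card_sigma_ringHom_eq_sum₅₂ : Fintype.card ((i : I) × (K i →+* ℂ)) = ∑ i, finrank ℚ (K i) := by
  rw [Fintype.card_sigma]
  exact Finset.sum_congr rfl fun i _ => Embeddings.card (K i) ℂ

/-! ### §1 The exact criterion for CM types -/

section Types

omit [∀ i, IsCMField (K i)] [Fintype I] [DecidableEq I] in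
/-- **Relative pair flips make the base a pair-flip field**: every conjugate pair of embeddings of `K_{i₀}` is exchanged
by an automorphism of `ℂ` fixing the other embeddings (every embedding of `K_{i₀}` extends to `K_{i₁}`).
[cite: MilneFT2022, Prop. 2.7 (a)] [cite: Dodson1984, §1.1] -/
theorem pairFlip_of_relPairFlip (j : K i₀ →+* K i₁)
    (hflip : ∀ x : K i₀ →+* ℂ, ∃ σ : ℂ ≃+* ℂ, σ • x = (starRingAut : ℂ ≃+* ℂ) • x ∧
      ∀ y : K i₁ →+* ℂ, y.comp j ≠ x → y.comp j ≠ (starRingAut : ℂ ≃+* ℂ) • x → σ • y = y) :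
    ∀ x : K i₀ →+* ℂ, ∃ σ : ℂ ≃+* ℂ, σ • x = (starRingAut : ℂ ≃+* ℂ) • x ∧
      ∀ x' : K i₀ →+* ℂ, x' ≠ x → x' ≠ (starRingAut : ℂ ≃+* ℂ) • x → σ • x' = x' :=
  Shadow.pairFlip_of_relFlip (G := ℂ ≃+* ℂ) (fun y : K i₁ →+* ℂ => y.comp j) (fun _ _ => rfl)
    (restrict_surjective j) hflip

/-- **THE EXACT CRITERION (rank form).**  `I = {i₀, i₁}`, `j : K_{i₀} → K_{i₁}`, relative pair flips: `rank(Φ₀, Φ₁) + 2 =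
rank Φ₀ + rank Φ₁ + 1` (`Hg(A₀ × A₁) = Hg(A₀) × Hg(A₁)`) IFF the multiplicities `n(x) = #{y ∈ Φ₁ | y ∘ j = x}` are NOT of
the form `a` on `Φ₀`, `b` off `Φ₀` with `a ≠ b`. [cite: Gordon1999HodgeAVSurvey, §3 Theorem (1), 7.5–7.7 and 9.4.3] -/
theorem cmFamilyRank_add_card_eq_iff_of_relPairFlip (hI : ∀ i, i = i₀ ∨ i = i₁) (h01 : i₀ ≠ i₁) (j : K i₀ →+* K i₁)
    (hflip : ∀ x : K i₀ →+* ℂ, ∃ σ : ℂ ≃+* ℂ, σ • x = (starRingAut : ℂ ≃+* ℂ) • x ∧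
      ∀ y : K i₁ →+* ℂ, y.comp j ≠ x → y.comp j ≠ (starRingAut : ℂ ≃+* ℂ) • x → σ • y = y) :
    CMAlgebra.cmFamilyRank Φ + Fintype.card I = (∑ i, cmTypeRank (Φ i)) + 1 ↔
      ¬ ∃ a b : ℕ, a ≠ b ∧ ∀ x : K i₀ →+* ℂ,
        (Finset.univ.filter fun y : K i₁ →+* ℂ => y.comp j = x ∧ y ∈ (Φ i₁).1).card =
          if x ∈ (Φ i₀).1 then a else b := by
  haveI := isPretransitive_ringEquiv_complex (K := K i₀)
  haveI := isPretransitive_ringEquiv_complex (K := K i₁)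
  haveI : Nonempty I := ⟨i₀⟩
  obtain ⟨x₀⟩ : Nonempty (K i₀ →+* ℂ) := inferInstance
  have hpf := pairFlip_of_relPairFlip j hflip
  exact Shadow.typeRank_sigmaType_add_card_eq_iff_not_exists_multiplicities_of_relFlip (G := ℂ ≃+* ℂ)
    (Φ := fun i => (Φ i).1) (fun i => isCMTypeWith_conj (Φ i)) hI h01
    (antiSpan_irreducible_of_pairFlip (isCMTypeWith_conj (Φ i₀)) hpf) (fun y : K i₁ →+* ℂ => y.comp j)
    (fun _ _ => rfl) (hflip x₀)

/-- **THE EXACT CRITERION (nondegeneracy form).**  `I = {i₀, i₁}`, `j : K_{i₀} → K_{i₁}`, relative pair flips: the pair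
`(Φ₀, Φ₁)` is nondegenerate (`B• = D•` on all `A₀^a × A₁^b`) IFF `Φ₁` is nondegenerate AND its multiplicities over
`Hom(K_{i₀}, ℂ)` are not constant-unequal over `Φ₀` / off `Φ₀`.  (`Φ₀` itself is automatically nondegenerate.)
[cite: Gordon1999HodgeAVSurvey, 7.5–7.7 and 9.4.3] [cite: Dodson1984, §5.1.2] -/
theorem isNondegenerateFamily_iff_of_relPairFlip (hI : ∀ i, i = i₀ ∨ i = i₁) (h01 : i₀ ≠ i₁) (j : K i₀ →+* K i₁)
    (hflip : ∀ x : K i₀ →+* ℂ, ∃ σ : ℂ ≃+* ℂ, σ • x = (starRingAut : ℂ ≃+* ℂ) • x ∧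
      ∀ y : K i₁ →+* ℂ, y.comp j ≠ x → y.comp j ≠ (starRingAut : ℂ ≃+* ℂ) • x → σ • y = y) :
    CMAlgebra.IsNondegenerateFamily Φ ↔ IsNondegenerate (Φ i₁) ∧
      ¬ ∃ a b : ℕ, a ≠ b ∧ ∀ x : K i₀ →+* ℂ,
        (Finset.univ.filter fun y : K i₁ →+* ℂ => y.comp j = x ∧ y ∈ (Φ i₁).1).card =
          if x ∈ (Φ i₀).1 then a else b := by
  haveI := isPretransitive_ringEquiv_complex (K := K i₀)
  haveI := isPretransitive_ringEquiv_complex (K := K i₁)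
  haveI : Nonempty I := ⟨i₀⟩
  have key := Shadow.typeRank_sigmaType_eq_iff_of_forall_relFlip (G := ℂ ≃+* ℂ) (Φ := fun i => (Φ i).1)
    (fun i => isCMTypeWith_conj (Φ i)) hI h01 (fun y : K i₁ →+* ℂ => y.comp j) (fun _ _ => rfl)
    (restrict_surjective j) hflip
  rw [CMAlgebra.isNondegenerateFamily_iff, ← card_sigma_ringHom_eq_sum₅₂ (K := K), isNondegenerate_iff, cmTypeRank,
    ← Embeddings.card (K i₁) ℂ]
  exact key

omit [Fintype I] [DecidableEq I] in
/-- **The base type is nondegenerate** under relative pair flips (pair-flip fields have only nondegenerate types).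
[cite: Dodson1984, §5.1.2] -/
theorem isNondegenerate_base_of_relPairFlip (j : K i₀ →+* K i₁)
    (hflip : ∀ x : K i₀ →+* ℂ, ∃ σ : ℂ ≃+* ℂ, σ • x = (starRingAut : ℂ ≃+* ℂ) • x ∧
      ∀ y : K i₁ →+* ℂ, y.comp j ≠ x → y.comp j ≠ (starRingAut : ℂ ≃+* ℂ) • x → σ • y = y) :
    IsNondegenerate (Φ i₀) := by
  haveI := isPretransitive_ringEquiv_complex (K := K i₀)
  rw [isNondegenerate_iff, cmTypeRank, ← Embeddings.card (K i₀) ℂ]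
  exact typeRank_eq_of_pairFlip (isCMTypeWith_conj (Φ i₀)) (pairFlip_of_relPairFlip j hflip)

omit [DecidableEq I] in
/-- **Constant unequal multiplicities ⟹ the pair is degenerate** (the rank is not additive) — gen 49's Yanai-for-pairs with
`Φ₀` lying over itself with multiplicities `(1, 0)`; no flip hypothesis is needed for this direction.
[cite: Gordon1999HodgeAVSurvey, 9.4.3 and 7.5] -/
theorem cmFamilyRank_add_card_lt_of_multiplicities_self (h01 : i₀ ≠ i₁) (j : K i₀ →+* K i₁) {a b : ℕ}
    (hmult : ∀ x : K i₀ →+* ℂ, (Finset.univ.filter fun y : K i₁ →+* ℂ => y.comp j = x ∧ y ∈ (Φ i₁).1).card =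
      if x ∈ (Φ i₀).1 then a else b) (hab : a ≠ b) :
    CMAlgebra.cmFamilyRank Φ + Fintype.card I < (∑ i, cmTypeRank (Φ i)) + 1 := by
  haveI : Nonempty I := ⟨i₀⟩
  refine cmFamilyRank_add_card_lt_of_multiplicities h01 (RingHom.id (K i₀)) j Φ (Φ i₀) (a₀ := 1) (b₀ := 0)
    (fun x => ?_) hmult one_ne_zero hab
  by_cases hx : x ∈ (Φ i₀).1
  · rw [if_pos hx, Finset.card_eq_one]
    refine ⟨x, Finset.ext fun y => ?_⟩
    simp only [Finset.mem_filter, Finset.mem_univ, true_and, Finset.mem_singleton, RingHom.comp_id]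
    exact ⟨fun h => h.1, fun h => ⟨h, h ▸ hx⟩⟩
  · rw [if_neg hx, Finset.card_eq_zero, Finset.filter_eq_empty_iff]
    intro y _ h
    rw [RingHom.comp_id] at h
    exact hx (h.1 ▸ h.2)

/-- **COLLAPSE in the exceptional case**: with relative pair flips, if `Φ₁` lies over `Φ₀` with constant unequal
multiplicities then `rank(Φ₀, Φ₁) = rank Φ₁` exactly — the Mumford–Tate group of `A₀ × A₁` is isogenous to that of
`A₁` (`U(Φ₀)` irreducible: additive or collapse, and additive is excluded). [cite: Gordon1999HodgeAVSurvey, §3 Theorem (proof), 7.5 and 9.4.3] -/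
theorem cmFamilyRank_eq_cmTypeRank_of_multiplicities (hI : ∀ i, i = i₀ ∨ i = i₁) (h01 : i₀ ≠ i₁) (j : K i₀ →+* K i₁)
    (hflip : ∀ x : K i₀ →+* ℂ, ∃ σ : ℂ ≃+* ℂ, σ • x = (starRingAut : ℂ ≃+* ℂ) • x ∧
      ∀ y : K i₁ →+* ℂ, y.comp j ≠ x → y.comp j ≠ (starRingAut : ℂ ≃+* ℂ) • x → σ • y = y)
    {a b : ℕ}
    (hmult : ∀ x : K i₀ →+* ℂ, (Finset.univ.filter fun y : K i₁ →+* ℂ => y.comp j = x ∧ y ∈ (Φ i₁).1).card =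
      if x ∈ (Φ i₀).1 then a else b) (hab : a ≠ b) :
    CMAlgebra.cmFamilyRank Φ = cmTypeRank (Φ i₁) := by
  haveI := isPretransitive_ringEquiv_complex (K := K i₀)
  haveI : Nonempty I := ⟨i₀⟩
  have hpf := pairFlip_of_relPairFlip j hflip
  rcases PairFlipTransport.typeRank_add_card_eq_or_typeRank_eq_of_irreducible (G := ℂ ≃+* ℂ)
      (Φ := fun i => (Φ i).1) (fun i => isCMTypeWith_conj (Φ i)) hI h01
      (antiSpan_irreducible_of_pairFlip (isCMTypeWith_conj (Φ i₀)) hpf) with hadd | hcol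
  · have hlt := cmFamilyRank_add_card_lt_of_multiplicities_self (Φ := Φ) h01 j hmult hab
    change CMAlgebra.cmFamilyRank Φ + Fintype.card I = (∑ i, cmTypeRank (Φ i)) + 1 at hadd
    omega
  · exact hcol

end Types

/-! ### §2 Quadratic steps: induced types are degenerate, so the criterion is «`Φ₁` nondegenerate» -/

section OneStep

variable {K₀ K₁ : Type} [Field K₀] [Field K₁] [NumberField K₁] [IsCMField K₁] (j : K₀ →+* K₁) (Φ₁ : CMType K₁)

/-- **Kubota: a type that is constant on the fibres of a proper subfield is not nondegenerate** (it is induced from the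
subfield, hence imprimitive): if `y ∈ Φ₁ ↔ y' ∈ Φ₁` whenever `y|_{K₀} = y'|_{K₀}`, and some fibre has two points, the
translates of `Φ₁` do not separate them. [cite: Kubota1965, §2 Lemma 2] -/
theorem not_isNondegenerate_of_fibrewise
    (hfw : ∀ y y' : K₁ →+* ℂ, y.comp j = y'.comp j → (y ∈ Φ₁.1 ↔ y' ∈ Φ₁.1)) {y y' : K₁ →+* ℂ}
    (hyy' : y.comp j = y'.comp j) (hne : y ≠ y') : ¬ IsNondegenerate Φ₁ := fun hnd =>
  hne (hnd.eq_of_forall_comp_mem_iff fun τ => hfw _ _ (by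
    change (τ • y).comp j = (τ • y').comp j
    rw [smul_comp_ringHom, smul_comp_ringHom, hyy']))

variable [NumberField K₀] [IsCMField K₀] (Φ₀ : CMType K₀)

/-- **Multiplicities `(a, 0)` or `(0, b)` make `Φ₁` constant on fibres**: over each `x` the points of `Φ₁` are all or
none of the fibre. [cite: Gordon1999HodgeAVSurvey, 9.4.3] -/
theorem fibrewise_of_multiplicities_zero {a b : ℕ}
    (hmult : ∀ x : K₀ →+* ℂ, (Finset.univ.filter fun y : K₁ →+* ℂ => y.comp j = x ∧ y ∈ Φ₁.1).card =
      if x ∈ Φ₀.1 then a else b) (h0 : a = 0 ∨ b = 0) (y y' : K₁ →+* ℂ) (hyy' : y.comp j = y'.comp j) :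
    y ∈ Φ₁.1 ↔ y' ∈ Φ₁.1 := by
  have hfib : (Finset.univ.filter fun w : K₁ →+* ℂ => w.comp j = y.comp j).card = a + b :=
    card_fibre_restrict_eq j hmult (y.comp j)
  -- the count over `x = y|_{K₀}` is `0` or the whole fibre
  have hcnt : (Finset.univ.filter fun w : K₁ →+* ℂ => w.comp j = y.comp j ∧ w ∈ Φ₁.1).card = 0 ∨
      (Finset.univ.filter fun w : K₁ →+* ℂ => w.comp j = y.comp j ∧ w ∈ Φ₁.1).card =
        (Finset.univ.filter fun w : K₁ →+* ℂ => w.comp j = y.comp j).card := by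
    rw [hmult (y.comp j), hfib]
    rcases h0 with rfl | rfl
    · by_cases hx : y.comp j ∈ Φ₀.1
      · rw [if_pos hx]; exact Or.inl rfl
      · rw [if_neg hx]; exact Or.inr (by rw [zero_add])
    · by_cases hx : y.comp j ∈ Φ₀.1
      · rw [if_pos hx]; exact Or.inr (by rw [add_zero])
      · rw [if_neg hx]; exact Or.inl rfl
  rcases hcnt with h0' | hall
  · rw [Finset.card_eq_zero, Finset.filter_eq_empty_iff] at h0'
    have hy : y ∉ Φ₁.1 := fun h => h0' (Finset.mem_univ y) ⟨rfl, h⟩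
    have hy' : y' ∉ Φ₁.1 := fun h => h0' (Finset.mem_univ y') ⟨hyy'.symm, h⟩
    exact ⟨fun h => absurd h hy, fun h => absurd h hy'⟩
  · have hsub : (Finset.univ.filter fun w : K₁ →+* ℂ => w.comp j = y.comp j ∧ w ∈ Φ₁.1) =
        Finset.univ.filter fun w : K₁ →+* ℂ => w.comp j = y.comp j :=
      Finset.eq_of_subset_of_card_le (fun w hw => by
        simp only [Finset.mem_filter, Finset.mem_univ, true_and] at hw ⊢
        exact hw.1) hall.ge
    have hmem : ∀ w : K₁ →+* ℂ, w.comp j = y.comp j → w ∈ Φ₁.1 := fun w hw => by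
      have h1 : w ∈ Finset.univ.filter fun w : K₁ →+* ℂ => w.comp j = y.comp j := by
        simp only [Finset.mem_filter, Finset.mem_univ, true_and]; exact hw
      rw [← hsub] at h1
      simp only [Finset.mem_filter, Finset.mem_univ, true_and] at h1
      exact h1.2
    exact ⟨fun _ => hmem y' hyy'.symm, fun _ => hmem y rfl⟩

/-- **Constant multiplicities `(a, 0)` / `(0, b)` with fibres of at least two points ⟹ `Φ₁` is NOT nondegenerate** — the
type is induced from `Φ₀` resp. `Φ̄₀` (Kubota, Lemma 2: types lifted from a proper subfield are degenerate).
[cite: Kubota1965, §2 Lemma 2] [cite: Gordon1999HodgeAVSurvey, 9.4.3] -/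
theorem not_isNondegenerate_of_multiplicities_zero {a b : ℕ}
    (hmult : ∀ x : K₀ →+* ℂ, (Finset.univ.filter fun y : K₁ →+* ℂ => y.comp j = x ∧ y ∈ Φ₁.1).card =
      if x ∈ Φ₀.1 then a else b) (h0 : a = 0 ∨ b = 0) (h2 : 2 ≤ a + b) : ¬ IsNondegenerate Φ₁ := by
  obtain ⟨x₀⟩ : Nonempty (K₀ →+* ℂ) := inferInstance
  have hfib : (Finset.univ.filter fun w : K₁ →+* ℂ => w.comp j = x₀).card = a + b :=
    card_fibre_restrict_eq j hmult x₀
  obtain ⟨y, hy, y', hy', hne⟩ := Finset.one_lt_card.1 (by rw [hfib]; omega)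
  simp only [Finset.mem_filter, Finset.mem_univ, true_and] at hy hy'
  exact not_isNondegenerate_of_fibrewise j Φ₁ (fibrewise_of_multiplicities_zero j Φ₁ Φ₀ hmult h0) (hy.trans hy'.symm)
    hne

/-- **Quadratic steps**: if `[K₁ : ℚ] = 2 [K₀ : ℚ]` (every fibre has two points) and `Φ₁` lies over `Φ₀` with constant
multiplicities `a ≠ b`, then `(a, b) ∈ {(2,0), (0,2)}` and `Φ₁` is NOT nondegenerate. [cite: Kubota1965, §2 Lemma 2] -/
theorem not_isNondegenerate_of_multiplicities_of_quadratic (hdeg : finrank ℚ K₁ = 2 * finrank ℚ K₀) {a b : ℕ}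
    (hmult : ∀ x : K₀ →+* ℂ, (Finset.univ.filter fun y : K₁ →+* ℂ => y.comp j = x ∧ y ∈ Φ₁.1).card =
      if x ∈ Φ₀.1 then a else b) (hab : a ≠ b) : ¬ IsNondegenerate Φ₁ := by
  -- `(a + b) · [K₀ : ℚ] = [K₁ : ℚ]`
  have hsum : Fintype.card (K₁ →+* ℂ) = ∑ x : K₀ →+* ℂ, (a + b) := by
    rw [← Finset.card_univ, Finset.card_eq_sum_card_fiberwise (f := fun y : K₁ →+* ℂ => y.comp j) (t := Finset.univ)
      fun _ _ => Finset.mem_coe.2 (Finset.mem_univ _)]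
    exact Finset.sum_congr rfl fun x _ => card_fibre_restrict_eq j hmult x
  rw [Finset.sum_const, Finset.card_univ, smul_eq_mul, Embeddings.card, Embeddings.card, hdeg, mul_comm] at hsum
  have hpos : finrank ℚ K₀ ≠ 0 := Module.finrank_pos.ne'
  have hab2 : a + b = 2 := (mul_left_cancel₀ hpos hsum).symm
  refine not_isNondegenerate_of_multiplicities_zero j Φ₁ Φ₀ hmult ?_ hab2.ge
  omega

end OneStep

section QuadraticFamily

/-- **THE QUADRATIC CASE.**  `I = {i₀, i₁}`, `j : K_{i₀} → K_{i₁}` with `[K_{i₁} : ℚ] = 2 [K_{i₀} : ℚ]` and relative pair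
flips: the pair `(Φ₀, Φ₁)` is nondegenerate IFF `Φ₁` is nondegenerate — for EVERY pair of types (the constant-unequal
case is an induced, degenerate `Φ₁`). [cite: Gordon1999HodgeAVSurvey, 7.5–7.7 and 9.4.3] [cite: Kubota1965, §2 Lemma 2] -/
theorem isNondegenerateFamily_iff_of_relPairFlip_of_quadratic (hI : ∀ i, i = i₀ ∨ i = i₁) (h01 : i₀ ≠ i₁)
    (j : K i₀ →+* K i₁) (hdeg : finrank ℚ (K i₁) = 2 * finrank ℚ (K i₀))
    (hflip : ∀ x : K i₀ →+* ℂ, ∃ σ : ℂ ≃+* ℂ, σ • x = (starRingAut : ℂ ≃+* ℂ) • x ∧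
      ∀ y : K i₁ →+* ℂ, y.comp j ≠ x → y.comp j ≠ (starRingAut : ℂ ≃+* ℂ) • x → σ • y = y) :
    CMAlgebra.IsNondegenerateFamily Φ ↔ IsNondegenerate (Φ i₁) := by
  rw [isNondegenerateFamily_iff_of_relPairFlip hI h01 j hflip]
  refine ⟨fun h => h.1, fun hnd => ⟨hnd, ?_⟩⟩
  rintro ⟨a, b, hab, hmult⟩
  exact not_isNondegenerate_of_multiplicities_of_quadratic j (Φ i₁) (Φ i₀) hdeg hmult hab hnd

end QuadraticFamily

end Summit.HodgeConjecture.CorCM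

end
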